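import Literature.Computability.AlgebraicComplexity.BurgisserBooleanPartsModPCircuits
import Literature.Computability.Complexity.CircuitClassesProofs
import HarnessLib

/-!
# `B₂`-circuits for modular exponentiation by a hard-wired exponent, masked parities and
pattern tests (gadgets for non-uniform cryptographic reductions)

Small additions to the bus calculus `CktSizeVia` / `HasBits` of
`AlgebraicComplexity/BurgisserBooleanPartsModPCircuits.lean` (school arithmetic modulo `p` by
fan-in-two Boolean straight-line programs), as needed to turn the simulator of a NON-UNIFORM
security reduction (Naor–Reingold 2004, proof of Thm. 4.1: every oracle answer is a hard-wired
power `(g^b)^{∏ a_i}` of a challenge element) into a polynomial-size circuit: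

* `HasBits.pow` — **modular exponentiation of an available residue by a hard-wired exponent**
  `k < 2^w`, by `w` square-and-multiply steps with the exponent word on the bus (CLRS 2009,
  §31.6, MODULAR-EXPONENTIATION, left-to-right binary method), cost
  `s + ℓ + w + w · powStepCost ℓ w`, `powStepCost = 2 · modMulCost ℓ + ℓ + w` (cubic in `ℓ`);
* `CktSizeVia.maskedParity` — the parity `⊕_i (c_i ∧ a_i)` of bus wires against a hard-wired
  mask (one gate per wire; used for the inner-product hash bit `⟨r, u⟩`), with
  `maskedParity_finRange_eq_bodd`;
* `CktSizeVia.allMatch` — the test "the wires `a_i` spell the hard-wired pattern `c_i`"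
  (one gate per wire), with `allMatch_finRange_eq_decide`;
* `CktSizeVia.exists_circuit` — packaging a single-output bus program as a `Circuit` over `B₂`
  whose value on every encoded parameter is the specified bit.

Everything is proved.

## References

* T. H. Cormen, C. E. Leiserson, R. L. Rivest, C. Stein, *Introduction to Algorithms*, 3rd ed.,
  MIT Press 2009, §31.6 (MODULAR-EXPONENTIATION and its loop invariant).
* M. Naor, O. Reingold, J. ACM 51 (2004), proof of Thm. 4.1 (pp. 250–251).
* H. Vollmer, *Introduction to Circuit Complexity*, Springer 1999, §1.2 (composition).
-/

noncomputable section

namespace Literature.Computability.Cryptography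

open Literature.Computability.AlgebraicComplexity Literature.Computability.Complexity

/-! ### Packaging, parities and pattern tests on a bus -/

section Gadgets

variable {θ α : Type*}

/-- **From a bus program to a circuit**: a single-output `B₂`-program reading the bus `e` with
specification `f` yields a `B₂`-circuit of the same size whose value at every encoded parameter
`e t` is `f t`. [cite: Vollmer1999, §1.2] -/
theorem CktSizeVia.exists_circuit {e : θ → α → Bool} {f : θ → Bool} {s : ℕ}
    (h : CktSizeVia e (fun t (_ : Unit) => f t) s) :
    ∃ C : Circuit α, C.IsOver B2 ∧ C.size ≤ s ∧ ∀ t, C.eval (e t) = f t := by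
  obtain ⟨F, hF, hf⟩ := h
  obtain ⟨C, hB, hs, hev⟩ := hF.toCircuit
  exact ⟨C, hB, hs, fun t => by rw [hev]; exact congrFun (hf t) ()⟩

/-- The parity `⊕_{i ∈ ws} (c_i ∧ a_i)` of the wires `ws` masked by the constants `c`. [folklore] -/
def maskedParity (ws : List α) (c a : α → Bool) : Bool :=
  ws.foldr (fun i b => xor (c i && a i) b) false

/-- **Masked parity on a bus**: one binary gate per listed wire (plus the initial constant). [cite: Vollmer1999, §1.2] -/
theorem CktSizeVia.maskedParity (e : θ → α → Bool) (c : α → Bool) :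
    ∀ ws : List α, CktSizeVia e (fun t (_ : Unit) => maskedParity ws c (e t)) (ws.length + 1)
  | [] => CktSizeVia.of_cktSize (cktSize_const α false) fun _ => rfl
  | i :: ws => by
    have h := ((CktSizeVia.maskedParity e c ws).extend).trans
      (CktSizeVia.binop (fun t => Sum.elim (e t) (fun _ : Unit => Cryptography.maskedParity ws c (e t)))
        (fun x y => xor (c i && x) y) (Sum.inl i) (Sum.inr ()))
    refine (h.congr fun t => ?_).of_le (by simp)
    funext u
    simp [Cryptography.maskedParity, List.foldr_cons]

/-- `bodd` of an indicator. [folklore] -/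
theorem bodd_toNat' (b : Bool) : b.toNat.bodd = b := by cases b <;> rfl

/-- The masked parity over all of `Fin M` is the parity of the number of positions with
`c_i ∧ a_i`. [folklore] -/
theorem maskedParity_finRange_eq_bodd : ∀ (M : ℕ) (c a : Fin M → Bool),
    maskedParity (List.finRange M) c a = (∑ i : Fin M, (c i && a i).toNat).bodd
  | 0, c, a => by simp [maskedParity]
  | M + 1, c, a => by
    rw [List.finRange_succ, Fin.sum_univ_succ, Nat.bodd_add, bodd_toNat']
    simp only [maskedParity, List.foldr_cons, List.foldr_map]
    have ih := maskedParity_finRange_eq_bodd M (fun i => c i.succ) (fun i => a i.succ)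
    simp only [maskedParity] at ih
    rw [ih]

/-- The test "every listed wire `a_i` equals the constant `c_i`". [folklore] -/
def allMatch (ws : List α) (c a : α → Bool) : Bool :=
  ws.foldr (fun i b => (a i == c i) && b) true

/-- **Pattern test on a bus**: one binary gate per listed wire (plus the initial constant). [cite: Vollmer1999, §1.2] -/
theorem CktSizeVia.allMatch (e : θ → α → Bool) (c : α → Bool) :
    ∀ ws : List α, CktSizeVia e (fun t (_ : Unit) => allMatch ws c (e t)) (ws.length + 1)
  | [] => CktSizeVia.of_cktSize (cktSize_const α true) fun _ => rfl
  | i :: ws => by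
    have h := ((CktSizeVia.allMatch e c ws).extend).trans
      (CktSizeVia.binop (fun t => Sum.elim (e t) (fun _ : Unit => Cryptography.allMatch ws c (e t)))
        (fun x y => (x == c i) && y) (Sum.inl i) (Sum.inr ()))
    refine (h.congr fun t => ?_).of_le (by simp)
    funext u
    simp [Cryptography.allMatch, List.foldr_cons]

/-- The pattern test over all of `Fin M` decides `a = c`. [folklore] -/
theorem allMatch_finRange_eq_decide (M : ℕ) (c a : Fin M → Bool) :
    allMatch (List.finRange M) c a = decide (a = c) := by
  have key : ∀ ws : List (Fin M), allMatch ws c a = decide (∀ i ∈ ws, a i = c i) := by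
    intro ws
    induction ws with
    | nil => simp [allMatch]
    | cons i ws ih =>
      simp only [allMatch, List.foldr_cons, List.forall_mem_cons] at ih ⊢
      rw [ih]
      cases h : (a i == c i) <;> simp_all
  rw [key]
  by_cases h : a = c
  · subst h; simp
  · rw [decide_eq_false (fun h' => h (funext fun i => h' i (List.mem_finRange i))), decide_eq_false h]

end Gadgets

/-! ### Modular exponentiation by a hard-wired exponent -/

section Pow

variable {p : ℕ} [NeZero p]

/-- The state bus of the exponentiator: accumulator (`ℓ` bits), exponent word (`w` bits), base
(`ℓ` bits). [folklore] -/
def powEnc (ℓ w : ℕ) (st : ZMod p × ℕ × ZMod p) : Fin ℓ ⊕ (Fin w ⊕ Fin ℓ) → Bool :=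
  Sum.elim (testBits ℓ st.1.val) (Sum.elim (testBits w st.2.1) (testBits ℓ st.2.2.val))

/-- One left-to-right square-and-multiply step: `acc ↦ acc² · (y if the top exponent bit is set,
else 1)`, shift the exponent word (CLRS 2009, §31.6, MODULAR-EXPONENTIATION). [cite: CLRS2009, §31.6 (MODULAR-EXPONENTIATION)] -/
def powStep (w : ℕ) (st : ZMod p × ℕ × ZMod p) : ZMod p × ℕ × ZMod p :=
  (st.1 * st.1 * (if st.2.1.testBit (w - 1) then st.2.2 else 1), st.2.1 * 2 ^ 1, st.2.2)

/-- Gate count of one square-and-multiply step. [folklore] -/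
def powStepCost (ℓ w : ℕ) : ℕ := 2 * modMulCost ℓ + ℓ + w

/-- One square-and-multiply step on the state bus costs `powStepCost ℓ w` gates (`0 < w`). [cite: CLRS2009, §31.6] -/
theorem cktSizeVia_powStep {ℓ w : ℕ} (hℓ : p ≤ 2 ^ ℓ) (hw : 0 < w) :
    CktSizeVia (powEnc (p := p) ℓ w) (fun st => powEnc ℓ w (powStep w st)) (powStepCost ℓ w) := by
  have hacc : HasBits ℓ (powEnc (p := p) ℓ w) (fun st => st.1) 0 :=
    HasBits.ofWires Sum.inl fun _ _ => rfl
  have hy : HasBits ℓ (powEnc (p := p) ℓ w) (fun st => st.2.2) 0 :=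
    HasBits.ofWires (fun i => Sum.inr (Sum.inr i)) fun _ _ => rfl
  -- the selected factor `y` or `1`, bit by bit from the top exponent bit and the bits of `y`
  have hsel : HasBits ℓ (powEnc (p := p) ℓ w)
      (fun st => if st.2.1.testBit (w - 1) then st.2.2 else 1) (ℓ * 1) := by
    have h0 := CktSizeVia.pi_const (κ := Fin ℓ) (e := powEnc (p := p) ℓ w) (s := 1)
      (f := fun st => testBits ℓ (if st.2.1.testBit (w - 1) then st.2.2 else (1 : ZMod p)).val) fun i => by
      refine (CktSizeVia.binop (powEnc (p := p) ℓ w)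
        (fun cbit ybit => if cbit then ybit else (1 : ZMod p).val.testBit i)
        (Sum.inr (Sum.inl ⟨w - 1, by omega⟩)) (Sum.inr (Sum.inr i))).congr fun st => ?_
      funext u
      simp only [powEnc, Sum.elim_inr, Sum.elim_inl, testBits_apply]
      split <;> rfl
    rw [Fintype.card_fin] at h0
    exact h0
  have hprod : HasBits ℓ (powEnc (p := p) ℓ w)
      (fun st => st.1 * st.1 * (if st.2.1.testBit (w - 1) then st.2.2 else 1)) _ :=
    (hacc.mul hℓ hacc).mul hℓ hsel
  have hshift : CktSizeVia (powEnc (p := p) ℓ w) (fun st => testBits w (st.2.1 * 2 ^ 1)) (w * 1) := by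
    refine (CktSizeVia.pi_const (κ := Fin w) (e := powEnc (p := p) ℓ w) (s := 1)
      (f := fun st => testBits w (st.2.1 * 2 ^ 1)) fun i => ?_).of_le (by simp)
    by_cases h : (i : ℕ) = 0
    · refine CktSizeVia.of_cktSize (cktSize_const _ false) fun st => ?_
      funext u
      simp [h]
    · refine ((CktSizeVia.proj (powEnc (p := p) ℓ w) fun _ : Unit =>
        Sum.inr (Sum.inl ⟨i - 1, by omega⟩)).congr fun st => ?_).of_le zero_le_one
      funext u
      simp only [powEnc, Sum.elim_inr, Sum.elim_inl, testBits_apply, Nat.testBit_mul_two_pow]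
      rw [show decide (1 ≤ (i : ℕ)) = true from decide_eq_true (by omega), Bool.true_and]
  exact ((hprod.pair (hshift.pair hy)).congr fun st => rfl).of_le
    (by simp only [powStepCost]; omega)

omit [NeZero p] in
/-- Semantics of the square-and-multiply iteration started at `(1, k, y)` with `k < 2^w`: after
`i ≤ w` steps the accumulator is `y ^ ⌊k / 2^{w-i}⌋` and the exponent word is `k · 2^i`
(CLRS 2009, §31.6, loop invariant of MODULAR-EXPONENTIATION). [cite: CLRS2009, §31.6 (MODULAR-EXPONENTIATION, loop invariant)] -/
theorem powStep_iterate {w : ℕ} (y : ZMod p) {k : ℕ} (hk : k < 2 ^ w) :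
    ∀ i, i ≤ w → (powStep w)^[i] (1, k, y) = (y ^ (k / 2 ^ (w - i)), k * 2 ^ i, y)
  | 0, _ => by simp [Nat.div_eq_of_lt hk]
  | i + 1, hi => by
    rw [Function.iterate_succ_apply', powStep_iterate y hk i (Nat.le_of_succ_le hi)]
    set j := w - (i + 1) with hj
    have hj1 : w - i = j + 1 := by omega
    have hbit : (k * 2 ^ i).testBit (w - 1) = k.testBit j := by
      rw [Nat.testBit_mul_two_pow]
      rw [show decide (i ≤ w - 1) = true from decide_eq_true (by omega), Bool.true_and]
      congr 1
      omega
    have hdiv : k / 2 ^ j = 2 * (k / 2 ^ (j + 1)) + (k.testBit j).toNat := by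
      rw [Nat.toNat_testBit, pow_succ, ← Nat.div_div_eq_div_mul]
      exact (Nat.div_add_mod _ 2).symm
    simp only [powStep]
    refine Prod.ext ?_ (Prod.ext ?_ rfl)
    · simp only [hbit, hj1, hdiv]
      cases k.testBit j <;> simp [pow_add, pow_mul, sq] <;> ring
    · simp only
      ring

/-- Gate count of the exponentiator (exponent word of `w` bits, residues of `ℓ` bits). [folklore] -/
def powCost (ℓ w : ℕ) : ℕ := ℓ + w + w * powStepCost ℓ w

/-- **Modular exponentiation by a hard-wired exponent** (square-and-multiply, CLRS 2009,
§31.6): if the residues `v t` are available in binary from the bus at cost `s` and `k < 2^w`,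
then the bits of `(v t) ^ k` are available at cost `s + powCost ℓ w`. [cite: CLRS2009, §31.6 (MODULAR-EXPONENTIATION)] -/
theorem HasBits.pow {ℓ : ℕ} {θ α : Type*} {e : θ → α → Bool} {v : θ → ZMod p} {s : ℕ}
    (hℓ : p ≤ 2 ^ ℓ) (hv : HasBits ℓ e v s) {k w : ℕ} (hk : k < 2 ^ w) :
    HasBits ℓ e (fun t => v t ^ k) (s + powCost ℓ w) := by
  rcases Nat.eq_zero_or_pos w with rfl | hw
  · have hk0 : k = 0 := by simpa using hk
    subst hk0
    simp only [pow_zero]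
    exact (HasBits.const ℓ e (1 : ZMod p)).of_le (by simp [powCost])
  have hinit : CktSizeVia e (fun t => powEnc ℓ w ((1 : ZMod p), k, v t)) (ℓ * 1 + (w * 1 + s)) := by
    have h0 := ((CktSizeVia.constRow e (testBits ℓ (1 : ZMod p).val)).pair
      ((CktSizeVia.constRow e (testBits w k)).pair hv)).congr (g := fun t => powEnc ℓ w ((1 : ZMod p), k, v t))
      fun t => rfl
    rw [Fintype.card_fin, Fintype.card_fin] at h0
    exact h0
  have hiter := (cktSizeVia_powStep hℓ hw).iterate w
  have h := (hinit.trans (hiter.reparam fun t => ((1 : ZMod p), k, v t))).outMap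
    (Sum.inl : Fin ℓ → Fin ℓ ⊕ (Fin w ⊕ Fin ℓ))
  refine (h.congr fun t => ?_).of_le (by simp [powCost]; ring_nf; omega)
  funext i
  simp only [powEnc, Sum.elim_inl, powStep_iterate (v t) hk w le_rfl, Nat.sub_self, pow_zero,
    Nat.div_one]

end Pow

end Literature.Computability.Cryptography

end
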